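import Summits.MatrixMultiplication.MatrixMultiplication.Theorems.FarEdgeDescentChainCapSteps

/-!
# Far-edge descent, kernel XL-C₁ — the squaring criterion reduces to finitely many rational checks

`chain_cap` (kernel XL-B, `FarEdgeDescentChainCap`) caps the floor-projected β-dial along every chain
under ONE analytic hypothesis, the SQUARING CRITERION
`Crit(β,z,V_min,γ)`: for all shares `λ ∈ (0, 1/(2β−1)]` and narrownesses `V ∈ [0,1)` with
`V_sq(λ,V) := (2(1−βλ)V + zλV²)/(2−(2β−1)λ) ≥ V_min`,
`log(2(1−(β−1)λ)/(2−(2β−1)λ)) − log(4/3) ≤ γ·(log(1−V_sq) − log(1−V))`.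
This file reduces it to a finite table (memo NODE-g60 §2, `crit_of_checkpoints`):
* below the share `1/(β+1)` there is nothing to check (`crit_low`: no gain, nonnegative payment);
* MONOTONICITY: the gain is increasing in `λ` (`gain_mono`); `V_sq` is strictly increasing in `V`
  (`Vsq_lt_Vsq`) and non-increasing in `λ` (`Vsq_antitone_share`); and the payment
  `log((1−V_sq)/(1−V))` is non-decreasing in `V` (`payment_mono` — the algebraic identity
  `N(V)(1−W) − N(W)(1−V) = (V−W)·λ·(1 − z(V+W−VW))`, `N = (2−(2β−1)λ)(1−V_sq)`);
* hence on a share cell `[λ_a, λ_b]` one rational witness `W` with `V_sq(λ_a, W) ≤ V_min` and one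
  inequality `log(gain(λ_b)) − log(4/3) ≤ γ·log((1−V_min)/(1−W))` settle the criterion
  (`crit_cell`), and for `γ = 9/10` that inequality is the rational comparison
  `(3·gain/4)^10 ≤ ((1−V_min)/(1−W))^9` (`check_nine_tenths`); the cut-off condition of `chain_cap`
  with `1 − V† = (1−z)/6` is `(3·gain(λ*)/4)^10 ≤ 2^9` (`cutoff_nine_tenths`).
`FarEdgeDescentChainCapInstances` runs the table for `β = 3/2` and `β = 19/10`.

HONEST FRAMING: MODEL level, elementary real analysis; no `sorry`, no new axioms, no definitions.
References: kernel XL-B; Schönhage 1981 [Schonhage1981].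
-/

noncomputable section

set_option linter.dupNamespace false

namespace Summit.MatrixMultiplication.MatrixMultiplication.Theorems.FarEdgeDescentChainCapCriterion

open Summit.MatrixMultiplication.MatrixMultiplication.Theorems.FarEdgeDescentChainCapSteps

/-- The squaring gain `2(1−(β−1)λ)/(2−(2β−1)λ)` is non-decreasing in the share. -/
theorem gain_mono {β lam lb : ℝ} (hβ : 1 < β) (hle : lam ≤ lb) (hlb : (2 * β - 1) * lb ≤ 1) :
    2 * (1 - (β - 1) * lam) / (2 - (2 * β - 1) * lam) ≤
      2 * (1 - (β - 1) * lb) / (2 - (2 * β - 1) * lb) := by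
  have hD : 0 < 2 - (2 * β - 1) * lam := by nlinarith
  have hDb : 0 < 2 - (2 * β - 1) * lb := by linarith
  rw [div_le_div_iff₀ hD hDb]
  have : (1 - (β - 1) * lam) * (2 - (2 * β - 1) * lb) - (1 - (β - 1) * lb) * (2 - (2 * β - 1) * lam)
      = lam - lb := by ring
  nlinarith

/-- The squaring gain is positive on the window. -/
theorem gain_pos {β lam : ℝ} (hβ : 1 < β) (hlam : (2 * β - 1) * lam ≤ 1) :
    0 < 2 * (1 - (β - 1) * lam) / (2 - (2 * β - 1) * lam) := by
  have hD : 0 < 2 - (2 * β - 1) * lam := by linarith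
  have hc : 0 < 1 - (β - 1) * lam := by nlinarith
  positivity

/-- `V_sq` is strictly increasing in `V ≥ 0`. -/
theorem Vsq_lt_Vsq {β z lam V W : ℝ} (hβ : 1 < β) (hz0 : 0 ≤ z) (hlam0 : 0 ≤ lam)
    (hlam : (2 * β - 1) * lam ≤ 1) (hV0 : 0 ≤ V) (hVW : V < W) :
    (2 * (1 - β * lam) * V + z * lam * V ^ 2) / (2 - (2 * β - 1) * lam) <
      (2 * (1 - β * lam) * W + z * lam * W ^ 2) / (2 - (2 * β - 1) * lam) := by
  have hD : 0 < 2 - (2 * β - 1) * lam := by linarith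
  apply div_lt_div_of_pos_right _ hD
  have hp : 0 < 1 - β * lam := by nlinarith
  have hq : z * lam * V ^ 2 ≤ z * lam * W ^ 2 := by
    apply mul_le_mul_of_nonneg_left _ (mul_nonneg hz0 hlam0); nlinarith
  nlinarith [mul_lt_mul_of_pos_left hVW hp]

/-- `V_sq` is non-increasing in the share (for `zW ≤ 1`): coarser nodes degrade more. -/
theorem Vsq_antitone_share {β z la lam W : ℝ} (hβ : 1 < β) (hz1 : z ≤ 1) (hle : la ≤ lam)
    (hlam : (2 * β - 1) * lam ≤ 1) (hW0 : 0 ≤ W) (hW1 : W ≤ 1) :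
    (2 * (1 - β * lam) * W + z * lam * W ^ 2) / (2 - (2 * β - 1) * lam) ≤
      (2 * (1 - β * la) * W + z * la * W ^ 2) / (2 - (2 * β - 1) * la) := by
  have hD : 0 < 2 - (2 * β - 1) * lam := by linarith
  have hDa : 0 < 2 - (2 * β - 1) * la := by nlinarith
  rw [div_le_div_iff₀ hD hDa]
  have hid : (2 * (1 - β * la) * W + z * la * W ^ 2) * (2 - (2 * β - 1) * lam) -
      (2 * (1 - β * lam) * W + z * lam * W ^ 2) * (2 - (2 * β - 1) * la) =
      2 * W * (1 - z * W) * (lam - la) := by ring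
  have hzW : 0 ≤ 1 - z * W := by nlinarith
  nlinarith [mul_nonneg (mul_nonneg hW0 hzW) (sub_nonneg.2 hle)]

/-- **The payment is non-decreasing in `V`.**  For `0 ≤ W ≤ V < 1`:
`(1 − V_sq(W))·(1 − V) ≤ (1 − V_sq(V))·(1 − W)`. -/
theorem payment_mono {β z lam V W : ℝ} (hz1 : z ≤ 1) (hlam0 : 0 ≤ lam)
    (hlam : (2 * β - 1) * lam ≤ 1) (hW0 : 0 ≤ W) (hWV : W ≤ V) (hV1 : V ≤ 1) :
    (1 - (2 * (1 - β * lam) * W + z * lam * W ^ 2) / (2 - (2 * β - 1) * lam)) * (1 - V) ≤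
      (1 - (2 * (1 - β * lam) * V + z * lam * V ^ 2) / (2 - (2 * β - 1) * lam)) * (1 - W) := by
  have hD : 0 < 2 - (2 * β - 1) * lam := by linarith
  have e : ∀ U : ℝ, 1 - (2 * (1 - β * lam) * U + z * lam * U ^ 2) / (2 - (2 * β - 1) * lam) =
      ((2 - (2 * β - 1) * lam) - 2 * (1 - β * lam) * U - z * lam * U ^ 2)
        / (2 - (2 * β - 1) * lam) := by
    intro U; rw [eq_div_iff hD.ne', sub_mul, div_mul_cancel₀ _ hD.ne']; ring
  rw [e W, e V, div_mul_eq_mul_div, div_mul_eq_mul_div]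
  apply div_le_div_of_nonneg_right _ hD.le
  have hid : ((2 - (2 * β - 1) * lam) - 2 * (1 - β * lam) * V - z * lam * V ^ 2) * (1 - W) -
      ((2 - (2 * β - 1) * lam) - 2 * (1 - β * lam) * W - z * lam * W ^ 2) * (1 - V) =
      (V - W) * lam * (1 - z * (V + W - V * W)) := by ring
  have h3 : 0 ≤ 1 - z * (V + W - V * W) := by
    have : V + W - V * W ≤ 1 := by nlinarith [mul_nonneg (sub_nonneg.2 hV1) (sub_nonneg.2 (hW0.trans hWV))]
    have : 0 ≤ V + W - V * W := by nlinarith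
    nlinarith
  nlinarith [mul_nonneg (mul_nonneg (sub_nonneg.2 hWV) hlam0) h3]

/-- **No check below the share `1/(β+1)`.** -/
theorem crit_low {β z Vmin γ lam V : ℝ} (hβ : 1 < β) (hz1 : z ≤ 1) (hγ : 0 ≤ γ)
    (hlam0 : 0 < lam) (hlam : (2 * β - 1) * lam ≤ 1) (hsmall : (β + 1) * lam ≤ 1)
    (hV0 : 0 ≤ V) (hV1 : V < 1) :
    Vmin ≤ (2 * (1 - β * lam) * V + z * lam * V ^ 2) / (2 - (2 * β - 1) * lam) →
    Real.log (2 * (1 - (β - 1) * lam) / (2 - (2 * β - 1) * lam)) - Real.log (4 / 3) ≤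
      γ * (Real.log (1 - (2 * (1 - β * lam) * V + z * lam * V ^ 2) / (2 - (2 * β - 1) * lam))
        - Real.log (1 - V)) := by
  intro _
  have hg : Real.log (2 * (1 - (β - 1) * lam) / (2 - (2 * β - 1) * lam)) ≤ Real.log (4 / 3) :=
    Real.log_le_log (gain_pos hβ hlam) (gain_le_four_thirds hlam hsmall)
  have hle := Vsq_le (β := β) hz1 hlam0.le hlam hV0 hV1.le
  have hpay : Real.log (1 - V) ≤
      Real.log (1 - (2 * (1 - β * lam) * V + z * lam * V ^ 2) / (2 - (2 * β - 1) * lam)) :=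
    Real.log_le_log (by linarith) (by linarith)
  nlinarith [mul_nonneg hγ (sub_nonneg.2 hpay)]

/-- **One share cell, one rational witness.**  On `λ ∈ [λ_a, λ_b]`: if `V_sq(λ_a, W) ≤ V_min` for
some `W ∈ [0,1)` and `log gain(λ_b) − log(4/3) ≤ γ·(log(1−V_min) − log(1−W))`, the squaring
criterion holds on the cell. -/
theorem crit_cell {β z Vmin γ la lb W lam V : ℝ} (hβ : 1 < β) (hz0 : 0 ≤ z) (hz1 : z ≤ 1)
    (hγ : 0 ≤ γ) (hla : 0 < la) (hlb : (2 * β - 1) * lb ≤ 1) (hW0 : 0 ≤ W) (hW1 : W < 1)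
    (hVmin1 : Vmin < 1)
    (hroot : (2 * (1 - β * la) * W + z * la * W ^ 2) / (2 - (2 * β - 1) * la) ≤ Vmin)
    (hcheck : Real.log (2 * (1 - (β - 1) * lb) / (2 - (2 * β - 1) * lb)) - Real.log (4 / 3) ≤
      γ * (Real.log (1 - Vmin) - Real.log (1 - W)))
    (hale : la ≤ lam) (hleb : lam ≤ lb) (hV0 : 0 ≤ V) (hV1 : V < 1) :
    Vmin ≤ (2 * (1 - β * lam) * V + z * lam * V ^ 2) / (2 - (2 * β - 1) * lam) →
    Real.log (2 * (1 - (β - 1) * lam) / (2 - (2 * β - 1) * lam)) - Real.log (4 / 3) ≤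
      γ * (Real.log (1 - (2 * (1 - β * lam) * V + z * lam * V ^ 2) / (2 - (2 * β - 1) * lam))
        - Real.log (1 - V)) := by
  intro hfloor
  have hlam0 : 0 < lam := lt_of_lt_of_le hla hale
  have hlam : (2 * β - 1) * lam ≤ 1 := by nlinarith
  -- gain ≤ gain(lb)
  have hg : Real.log (2 * (1 - (β - 1) * lam) / (2 - (2 * β - 1) * lam)) ≤
      Real.log (2 * (1 - (β - 1) * lb) / (2 - (2 * β - 1) * lb)) :=
    Real.log_le_log (gain_pos hβ hlam) (gain_mono hβ hleb hlb)
  -- W ≤ V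
  have hWsq : (2 * (1 - β * lam) * W + z * lam * W ^ 2) / (2 - (2 * β - 1) * lam) ≤ Vmin :=
    (Vsq_antitone_share hβ hz1 hale hlam hW0 hW1.le).trans hroot
  have hWV : W ≤ V := by
    by_contra h
    have hlt := Vsq_lt_Vsq (β := β) (z := z) hβ hz0 hlam0.le hlam hV0 (not_le.mp h)
    linarith
  -- payment ≥ payment at W ≥ log(1−Vmin) − log(1−W)
  have hpm := payment_mono (β := β) (z := z) hz1 hlam0.le hlam hW0 hWV hV1.le
  have hVsqW_le : (2 * (1 - β * lam) * W + z * lam * W ^ 2) / (2 - (2 * β - 1) * lam) ≤ W :=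
    Vsq_le hz1 hlam0.le hlam hW0 hW1.le
  have hVsqV_le : (2 * (1 - β * lam) * V + z * lam * V ^ 2) / (2 - (2 * β - 1) * lam) ≤ V :=
    Vsq_le hz1 hlam0.le hlam hV0 hV1.le
  have hA : 0 < 1 - (2 * (1 - β * lam) * W + z * lam * W ^ 2) / (2 - (2 * β - 1) * lam) := by
    linarith
  have hB : 0 < 1 - (2 * (1 - β * lam) * V + z * lam * V ^ 2) / (2 - (2 * β - 1) * lam) := by
    linarith
  have h1V : 0 < 1 - V := by linarith
  have h1W : 0 < 1 - W := by linarith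
  have hlog := Real.log_le_log (mul_pos hA h1V) hpm
  rw [Real.log_mul hA.ne' h1V.ne', Real.log_mul hB.ne' h1W.ne'] at hlog
  have hmin : Real.log (1 - Vmin) ≤
      Real.log (1 - (2 * (1 - β * lam) * W + z * lam * W ^ 2) / (2 - (2 * β - 1) * lam)) :=
    Real.log_le_log (by linarith) (by linarith)
  have hpay : Real.log (1 - Vmin) - Real.log (1 - W) ≤
      Real.log (1 - (2 * (1 - β * lam) * V + z * lam * V ^ 2) / (2 - (2 * β - 1) * lam))
        - Real.log (1 - V) := by linarith
  have := mul_le_mul_of_nonneg_left hpay hγ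
  linarith

/-- The rational form of a cell check for `γ = 9/10`:
`(A/(4/3))^10 ≤ (x/y)^9` gives `log A − log(4/3) ≤ (9/10)(log x − log y)`. -/
theorem check_nine_tenths {A x y : ℝ} (hA : 0 < A) (hx : 0 < x) (hy : 0 < y)
    (hpow : (A / (4 / 3)) ^ 10 ≤ (x / y) ^ 9) :
    Real.log A - Real.log (4 / 3) ≤ 9 / 10 * (Real.log x - Real.log y) := by
  have h1 : Real.log ((A / (4 / 3)) ^ 10) ≤ Real.log ((x / y) ^ 9) :=
    Real.log_le_log (by positivity) hpow
  rw [Real.log_pow, Real.log_pow, Real.log_div hA.ne' (by norm_num), Real.log_div hx.ne' hy.ne']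
    at h1
  push_cast at h1
  linarith

/-- The cut-off condition of `chain_cap` with `1 − V† = (1−z)/6` and `γ = 9/10` is the rational
comparison `(3·gain(λ*)/4)^10 ≤ 2^9`, `gain(λ*) = 2β/(2β−1)`. -/
theorem cutoff_nine_tenths {β z : ℝ} (hβ : 1 < β) (hz1 : z < 1)
    (hpow : (2 * β / (2 * β - 1) / (4 / 3)) ^ 10 ≤ (2 : ℝ) ^ 9) :
    Real.log (2 * β / (2 * β - 1)) - Real.log (4 / 3) ≤
      9 / 10 * (Real.log ((1 - z) / 3) - Real.log (1 - (1 - (1 - z) / 6))) := by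
  have hA : 0 < 2 * β / (2 * β - 1) := div_pos (by linarith) (by linarith)
  have hx : 0 < (1 - z) / 3 := div_pos (by linarith) (by norm_num)
  have hy : 0 < 1 - (1 - (1 - z) / 6) := by linarith
  apply check_nine_tenths hA hx hy
  have : (1 - z) / 3 / (1 - (1 - (1 - z) / 6)) = 2 := by
    rw [div_eq_iff hy.ne']; ring
  rw [this]; exact hpow

end Summit.MatrixMultiplication.MatrixMultiplication.Theorems.FarEdgeDescentChainCapCriterion
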